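import Literature.Geometry.Riemannian.MetricFlowPhiInv
import Mathlib.Analysis.Calculus.MeanValue
import HarnessLib

/-!
# Lipschitz bound for Bamler's `Φ` and limits of `Φ⁻¹` (Bamler 2023, §3, (3.1); Bamler 2020a, §4.1)

R. Bamler, *Compactness theory of the space of super Ricci flows*, Invent. Math. 233 (2023), §3,
(3.1): `Φ : ℝ → (0, 1)` is the antiderivative of `(4π)^{-1/2} e^{-x²/4}` (the tree's
`MetricFlow.Phi`, `MetricFlow.lean`; calculus in `MetricFlowPhi.lean`, inverse `MetricFlow.PhiInv`
in `MetricFlowPhiInv.lean`). The gradient property of a metric flow (Bamler 2023, Def. 3.2 (6);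
Bamler 2020a, Thm. 4.1) writes conjugate heat flows as `Φ ∘ f` with `f` Lipschitz, and passing
such representations to limits uses the elementary one-variable facts proved here:

* `MetricFlow.deriv_Phi_le`, `nnnorm_deriv_Phi_le` — `Φ' ≤ (4π)^{-1/2}` (as `e^{-x²/4} ≤ 1`);
* `abs_Phi_sub_Phi_le`, `lipschitzWith_Phi` — `Φ` is `(4π)^{-1/2}`-Lipschitz (mean value theorem);
* `tendsto_PhiInv_nhdsGT_zero`, `tendsto_PhiInv_nhdsLT_one` — `Φ⁻¹(c) → −∞` as `c ↓ 0` and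
  `Φ⁻¹(c) → +∞` as `c ↑ 1`;
* `PhiInv_le_PhiInv` — `Φ⁻¹` is monotone on `(0, 1)`;
* `continuousAt_PhiInv`, `tendsto_PhiInv_comp` — `Φ⁻¹` is continuous at every point of `(0, 1)`,
  hence `Φ⁻¹ (u n) → Φ⁻¹ c` whenever `u n → c ∈ (0, 1)`.

Everything is proved; no definitions, no named facts. What is NOT here: the rescaled
`Φ_t(x) = Φ(t^{-1/2} x)` and its inverse `Φ_t⁻¹ = √t · Φ⁻¹`.

## References

* R. H. Bamler, *Compactness theory of the space of super Ricci flows*, Invent. Math. 233 (2023),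
  §3, (3.1) and Def. 3.2. [Bamler2023]
* R. H. Bamler, *Entropy and heat kernel bounds on a Ricci flow background*, arXiv:2008.07093
  (2020), §4.1. [Bamler2020Entropy]
-/

noncomputable section

open Set Filter
open scoped Topology NNReal

namespace Literature.Geometry.Riemannian

namespace MetricFlow

/-- **`Φ' ≤ (4π)^{-1/2}`**: since `Φ'(x) = (4π)^{-1/2} e^{-x²/4}` (Bamler 2023, (3.1)) and
`e^{-x²/4} ≤ 1`. [cite: Bamler2023, §3, (3.1)] -/
theorem deriv_Phi_le (x : ℝ) : deriv Phi x ≤ (Real.sqrt (4 * Real.pi))⁻¹ := by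
  rw [deriv_Phi]
  have h4 : 0 ≤ (Real.sqrt (4 * Real.pi))⁻¹ := inv_nonneg.2 (Real.sqrt_nonneg _)
  have hexp : Real.exp (-x ^ 2 / 4) ≤ 1 :=
    Real.exp_le_one_iff.2 (by nlinarith [sq_nonneg x])
  calc (Real.sqrt (4 * Real.pi))⁻¹ * Real.exp (-x ^ 2 / 4)
      ≤ (Real.sqrt (4 * Real.pi))⁻¹ * 1 := mul_le_mul_of_nonneg_left hexp h4
    _ = (Real.sqrt (4 * Real.pi))⁻¹ := mul_one _

/-- **`|Φ x − Φ y| ≤ (4π)^{-1/2} |x − y|`**: the mean value theorem with the bound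
`0 < Φ' ≤ (4π)^{-1/2}` of Bamler's `Φ` (Bamler 2023, (3.1)). [cite: Bamler2023, §3, (3.1)] -/
theorem abs_Phi_sub_Phi_le (x y : ℝ) :
    |Phi x - Phi y| ≤ (Real.sqrt (4 * Real.pi))⁻¹ * |x - y| := by
  have hb : ∀ z ∈ (univ : Set ℝ), ‖deriv Phi z‖ ≤ (Real.sqrt (4 * Real.pi))⁻¹ := fun z _ ↦ by
    rw [Real.norm_of_nonneg (deriv_Phi_pos z).le]
    exact deriv_Phi_le z
  have h := convex_univ.norm_image_sub_le_of_norm_deriv_le (fun z _ ↦ differentiable_Phi z) hb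
    (mem_univ y) (mem_univ x)
  simpa only [Real.norm_eq_abs] using h

/-- `‖Φ'(x)‖₊ ≤ (4π)^{-1/2}` (the bound `deriv_Phi_le` in `ℝ≥0`, the form the mean value
inequality consumes). [cite: Bamler2023, §3, (3.1)] -/
theorem nnnorm_deriv_Phi_le (x : ℝ) :
    ‖deriv Phi x‖₊ ≤ Real.toNNReal (Real.sqrt (4 * Real.pi))⁻¹ := by
  rw [← NNReal.coe_le_coe, coe_nnnorm, Real.norm_of_nonneg (deriv_Phi_pos x).le,
    Real.coe_toNNReal _ (inv_nonneg.2 (Real.sqrt_nonneg _))]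
  exact deriv_Phi_le x

/-- **`Φ` is `(4π)^{-1/2}`-Lipschitz** (Bamler 2023, (3.1): `Φ' = (4π)^{-1/2} e^{-x²/4} ≤
(4π)^{-1/2}`; mean value theorem). [cite: Bamler2023, §3, (3.1)] -/
theorem lipschitzWith_Phi : LipschitzWith (Real.toNNReal (Real.sqrt (4 * Real.pi))⁻¹) Phi :=
  lipschitzWith_of_nnnorm_deriv_le differentiable_Phi nnnorm_deriv_Phi_le

/-- **`Φ⁻¹(c) → −∞` as `c ↓ 0`** (`Φ⁻¹ : (0, 1) → ℝ` is the increasing inverse of `Φ`, and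
`Φ(b) > 0` for every `b`, so `Φ⁻¹ c ≤ b` once `0 < c < Φ b`; Bamler 2020a, §4.1).
[cite: Bamler2020Entropy, §4.1] -/
theorem tendsto_PhiInv_nhdsGT_zero : Tendsto PhiInv (𝓝[>] 0) atBot := by
  refine tendsto_atBot.2 fun b ↦ ?_
  filter_upwards [Ioo_mem_nhdsGT (Phi_pos b)] with c hc
  rw [← Phi_strictMono.le_iff_le, Phi_PhiInv hc.1 (hc.2.trans (Phi_lt_one b))]
  exact hc.2.le

/-- **`Φ⁻¹(c) → +∞` as `c ↑ 1`** (`Φ(b) < 1` for every `b`, so `b ≤ Φ⁻¹ c` once `Φ b < c < 1`;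
Bamler 2020a, §4.1). [cite: Bamler2020Entropy, §4.1] -/
theorem tendsto_PhiInv_nhdsLT_one : Tendsto PhiInv (𝓝[<] 1) atTop := by
  refine tendsto_atTop.2 fun b ↦ ?_
  filter_upwards [Ioo_mem_nhdsLT (Phi_lt_one b)] with c hc
  rw [← Phi_strictMono.le_iff_le, Phi_PhiInv ((Phi_pos b).trans hc.1) hc.2]
  exact hc.1.le

/-- `Φ⁻¹` is monotone on `(0, 1)`: `0 < a ≤ b < 1 ⟹ Φ⁻¹ a ≤ Φ⁻¹ b` (Bamler 2020a, §4.1).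
[cite: Bamler2020Entropy, §4.1] -/
theorem PhiInv_le_PhiInv {a b : ℝ} (ha : 0 < a) (hab : a ≤ b) (hb : b < 1) :
    PhiInv a ≤ PhiInv b :=
  PhiInv_strictMonoOn.monotoneOn ⟨ha, hab.trans_lt hb⟩ ⟨ha.trans_le hab, hb⟩ hab

/-- `Φ⁻¹` is continuous at every point of `(0, 1)` (Bamler 2020a, §4.1; it is `C^∞` there,
`contDiffOn_PhiInv`). [cite: Bamler2020Entropy, §4.1] -/
theorem continuousAt_PhiInv {c : ℝ} (hc0 : 0 < c) (hc1 : c < 1) : ContinuousAt PhiInv c :=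
  continuousOn_PhiInv.continuousAt (Ioo_mem_nhds hc0 hc1)

/-- Limits pass through `Φ⁻¹` inside `(0, 1)`: if `u n → c ∈ (0, 1)` then `Φ⁻¹ (u n) → Φ⁻¹ c`
(used pointwise when heat flows `Φ ∘ fₙ` converge; Bamler 2020a, §4.1).
[cite: Bamler2020Entropy, §4.1] -/
theorem tendsto_PhiInv_comp {u : ℕ → ℝ} {c : ℝ} (hc0 : 0 < c) (hc1 : c < 1)
    (hu : Tendsto u atTop (𝓝 c)) : Tendsto (fun n ↦ PhiInv (u n)) atTop (𝓝 (PhiInv c)) :=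
  (continuousAt_PhiInv hc0 hc1).tendsto.comp hu

end MetricFlow

end Literature.Geometry.Riemannian

end
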